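import Literature.MathematicalPhysics.QuantumFieldTheory.Balaban1983to89.B9Eq365QGGQLowerVariationalWindow
import Literature.MathematicalPhysics.QuantumFieldTheory.Balaban1983to89.B9Eq325ProjFormulaTower
import Literature.MathematicalPhysics.QuantumFieldTheory.Balaban1983to89.B9Thm311SitePrimeFormCoerciveTowerCanonical

/-!
# `Balaban1983to89.B9Eq365QGGQLowerVariationalWindowTower` — T. Bałaban, *Propagators for lattice gauge theories in a background field*, Commun.
# Math. Phys. **99** (1985) 389–434 [Balaban1985BackgroundPropagators] Thm 3.11 p. 416 with (3.19) p. 393, (3.24)–(3.25) p. 394, (3.35)–(3.37) p. 396,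
# and [Balaban1984PropagatorsI] (1.18) p. 20, [Balaban1984PropagatorsII] (2.74)–(2.77) p. 236: **PRINT's GENUINE `k`-LEVEL THIRD OPERATOR
# `Q̃′_kG′_k(U)²Q̃′_k(U)†` ON THE TOWER `T_{L^{n+1}m} → ⋯ → T_m` IS BOUNDED BELOW AT EVERY SMALL BACKGROUND OF THE WINDOW BY AN EXPLICIT, VOLUME-FREE
# CLOSED FORM IN `(d, N = L^{n+1}, η, c₀N^d∕c₁, a′, M_φ, M_φ′, ε, ρ_k)`, BY FORM BOUNDS ONLY** — the tower twin of ne9-leaf-01's one-shot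
# `B9Eq365QGGQLowerVariationalWindow.qggq_coercive_window` (the pub-balaban NE9 refuter's item KAPPA1, `k`-level half: «no decl» until this file; the
# level-free diagonal reading and the `∃ κ > 0`-first packaging are the sequel `B9Eq365QGGQLowerVariationalWindowTowerDiagonal`, same seat)

statement-level skeleton of published theorems with citation tags; proofs where landed; nothing here is a claim about the Yang–Mills mass gap

CITATION HEADER (lean-in-tree rule).  Audit cell `pub-balaban`, sub-cell `t4`, BINDER row NE9; filed by NE9 crux-team LEAF PROVER 03
(`b2b-balaban-t4-ne9-formalise-leaf-03`, gen 73).  LOCUS: the refuter desk's KEEP∕KILL draft (gen 45–48) §3 «the only NE9-weighted open item on the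
whole sheet is KAPPA1 … Print's GENUINE k-level third operator `Q̃′_kG′_k(U)²Q̃′_k(U)†` on `towerP` has NO decl»; t4-ne9-idea-1 g116 memo §E (E.1) «the
natural road is the same perturbation-of-a-section argument with the tower letters already in the Canonical file».  Composed BY NAME from: ne9-leaf-01's
abstract variational lemmas (`B9Eq365QGGQLowerVariational.sq_div_mul_le_re_inner_green`, `…sq_mul_norm_sq_le_re_inner_qggq`) and one-step tent letters
(`B9Eq319BlockTentLift`, `B9Eq365QGGQLowerVariationalWindow.norm_sq_lift_le` ∕ `abs_tent_le`) AT BLOCK SIZE `L^{n+1}`; the owner's tower objects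
(`B9Eq324DeltaPrimeATower.laplacePrimeAk` ∕ `GpOfUk`, `re_inner_laplacePrimeAk`, `Qtildek_one_eq_oneStep`; `B9Eq316TowerFlatIsOneStep.siteL2Cast`);
ne9-leaf-02's tower averaging letters (`B9Eq319QprimeTowerLipschitzL2.norm_QtildeTower_sub_flat_le` ∕ `…_one_le`); this lineage's g64 profile bound
(`B9Thm311SitePrimeFormCoerciveTowerCanonical.rhoTower_le_exp_sub_one`).  Sources READ in the held text (`paper:balaban1985-cmp99-background-propagators`,
journal page = PDF page + 388): p. 393 (3.19), p. 394 (3.24)–(3.25), p. 396 (3.35)–(3.37), p. 416 Thm 3.11; [Balaban1984PropagatorsI] p. 20 (1.18);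
[Balaban1984PropagatorsII] p. 236 (2.74)–(2.77) through the verbatim quotations of the tree's `B9Eq365QGGQLowerVariational`.

THE PRINT (verbatim).  [B9] p. 393 (3.19): *«Q′_j(U) = Q′(Ū^{j−1}) … Q′(Ū)Q′(U)»*; p. 394 (3.24)–(3.25): *«Δ′_a = Δ′_a(U) = D*_U D_U + Q′* a Q′, a > 0 …
G′ = G′(U) = (Δ′_a)⁻¹ … R(U) = I − G′Q′*(Q′G′²Q′*)⁻¹Q′G′»*; p. 416 Thm 3.11: *«the operators Δ′_a, G′, (Q′G′²Q′*)⁻¹, Δ_a, G are positive definite … uniformly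
bounded»*; [B5′] (1.18) p. 20: *«a composition of k transformations … is again a transformation of the same type with L replaced by L^k»*; [B6] p. 236:
the lower bound of `Q′G′Q′*` by *«a positive, absolute constant»* from one test field (2.74)–(2.77).

WHAT IS PROVED (sorry-free; proof lane — 0 `def`; axioms standard; [folklore] Hilbert-space algebra + real arithmetic on landed letters; nothing of
[B9]∕[B5′]∕[B6] asserted).
* §0 `siteL2Cast_symm_apply`, `norm_covDerivL2K_one_siteL2Cast` — the flat derivative does not see the typing `towerP L m (n+1) = fineP (L^{n+1}) m`.
* §1 **`qggq_coercive_window_tower`** — for `3 ≤ L^{n+1}`, `0 < a′`, fibre reading `φ` (`M_φ`, `M_φ′`), a background `U` on the finest torus with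
  `U(b) ∈ U1`, `‖U(b) − 1‖ ≤ ε`, level averages `‖Ū^j(b) − 1‖ ≤ ε_j` in `U1`, mutually adjoint transporters, the displayed positivity `hpos′` of
  `Δ′_{a′,k}(U)`, and the WINDOW `ρ_k·(N²∕4)^d ≤ β∕2` (`N = L^{n+1}`, `β = ((N−1)(N−2)∕6)^d`, `ρ_k = Π_{j≤n}(1 + 2M_φM_φ′ε_j)^{d(L−1)} − 1`): every coarse `ψ`
  has `κ_{U,k}·‖ψ‖² ≤ re⟪ψ, Q̃′_k(U)G′_k(U)²Q̃′_k(U)†ψ⟫` — the operator of `B9Eq325ProjFormulaTower.QGGQk_pos` VERBATIM — with the closed form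
  `κ_{U,k} = ((β∕2)²∕M)²·(c₀N^d∕c₁)∕(1+ρ_k)²`, `M = 2E + 2|η⁻¹|²(2M_φM_φ′ε)²d((N²∕4)^d)²(c₀N^d∕c₁) + a′(β + ρ_k(N²∕4)^d)²`, `E = |η⁻¹|²(N(N²∕4)^{d−1})²d(c₀N^d∕c₁)`.
  MECHANISM: the one-shot tent test vector at block size `L^{n+1}` carried to the tower typing by the site isometry; `Q̃′_k(1)` of it is `β·ψ`
  (`Qtildek_one_eq_oneStep` + `QprimeWL2_one_lift`); first-order variational principle + Cauchy–Schwarz at `T = Δ′_{a′,k}(U)`.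
SEQUEL (same seat, same day): `B9Eq365QGGQLowerVariationalWindowTowerDiagonal` — on print's diagonal `ηN = 1`, `c₀N^d = c₁` under the
geometric profile `ε_j ≤ αr^j` the closed form is `≥ κ₀(d, a′, 2M_φM_φ′)` (NO `n`, `L`, `r`, `η`, `m`, weights), and `∃ κ > 0` BEFORE `∀ L r`, `∃ α₁ > 0`
BEFORE `∀ n η c₀ c₁ m U …` — the KAPPA1 shape.
HONEST SCOPE.  Crude constants (the degenerate tent; no attempt at the pedestal's sharper flat value); the unitary letter `hRS`, the small-field
profile and `U, Ū^j ∈ U1` are DISPLAYED (print's running axioms (3.35)–(3.37) — the gauge question); the `L²` operator floor only — NOT the kernel decay of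
`(Q̃′_kG′_k²Q̃′_k†)⁻¹` (Thm 3.11's second half), NOT NE9, NOT the route (cell pub-balaban: NE9 NOT PRINTED ∕ NOT PROVED; «NE9 ⇐ the named binders»; row
WALLED ON A MODEL (O-NE9-1; #5 UNRULED); spine PROVED 0∕9; rung (B)+1 on a finite T⁴ — NOT infinite volume, NOT mass gap, NOT BetaPertH, NOT Clay; HONEST
DEPENDENCY: continuum YM on T⁴ ⇐ BetaPertH ∧ nine spine estimates (0/9 proved); BetaPertH ⇐ (D1) ∧ (D4) ∧ CAP+tail; G-an2-4 gates asym, D1 and NE2/3/4).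
NEW file importing `B9Eq365QGGQLowerVariationalWindow`, `B9Eq325ProjFormulaTower`, `B9Thm311SitePrimeFormCoerciveTowerCanonical` (all built); nothing
modified.  Net new unproved facts: 0.
-/

noncomputable section

open scoped InnerProductSpace ComplexConjugate BigOperators

namespace Literature.MathematicalPhysics.QuantumFieldTheory.Balaban1983to89.B9Eq365QGGQLowerVariationalWindowTower

open B4Sect5Torus (TSite)
open B9SectCLatticeCarrier (Bond)
open B7Prop1Explicit (U1)
open B9Eq311L2Pairing (WL2)
open B9Eq319QprimeTorus (fineP offset blockCoord)
open B11Eq103H1Complex (SiteL2K greenK covDerivL2K)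
open B9Eq310HessianOperator (adTransportW)
open B5Eq172HodgePositivity (adTransportW_one)
open B9Eq315QTower (towerP UlevOf)
open B9Eq326OperatorAssembly (QprimeW)
open B9Eq326OperatorTower (QprimeTowerW)
open B9Eq324DeltaPrimeATower (laplacePrimeAk laplacePrimeAk_isSymmetric re_inner_laplacePrimeAk GpOfUk Qtildek_one_eq_oneStep)
open B9Eq316TowerFlatIsOneStep (towerP_eq_fineP_pow siteL2Cast norm_siteL2Cast)
open B9Eq384RemainderLetters (norm_adTransportW_sub_le)
open B9Eq373DerivativeRemainderL2 (norm_covDerivL2K_sub_le)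
open B9Eq319QprimeTowerLipschitzL2 (norm_QtildeTower_sub_flat_le norm_QtildeTower_one_le)
open B9Eq319BlockTentLift (sum_profile_eq QprimeWL2_one_lift norm_sq_covDerivL2K_lift_le sum_blockOf_tent norm_tent_step_le)
open B9Eq365QGGQLowerVariational (sq_div_mul_le_re_inner_green sq_mul_norm_sq_le_re_inner_qggq)
open B9Eq365QGGQLowerVariationalWindow (norm_sq_lift_le abs_tent_le)
open B9Thm311SitePrimeFormCoerciveTowerCanonical (rhoTower_nonneg)

/-! ## §0 The flat derivative and the site isometry along `towerP L m (n+1) = fineP (L^{n+1}) m` -/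

section Cast

variable {d : ℕ} {P P' : Fin d → ℕ} {c₀ : ℝ} [Fact (0 < c₀)] {W : Type*} [NormedAddCommGroup W] [InnerProductSpace ℂ W]
  {𝔸 : Type*} [NormedRing 𝔸] [NormedAlgebra ℂ 𝔸] (φ : W ≃ₗ[ℂ] 𝔸)

omit [Fact (0 < c₀)] in
/-- The inverse of the site cast along `P = P′` is the site cast along `P′ = P`. [folklore] [cite: Balaban1985BackgroundPropagators, (3.11) p.392] -/
theorem siteL2Cast_symm_apply (h : P = P') (l : SiteL2K ℂ d P' c₀ W) : (siteL2Cast ℂ h).symm l = siteL2Cast ℂ h.symm l := by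
  subst h; rfl

/-- **The flat derivative does not see the typing of the periods**: `‖η⁻¹D_1(Φ′l)‖ = ‖η⁻¹D_1 l‖`. [folklore]
[cite: Balaban1985BackgroundPropagators, (3.3) pp.390–391, (3.11) p.392] -/
theorem norm_covDerivL2K_one_siteL2Cast (h : P = P') (c : ℂ) (l : SiteL2K ℂ d P c₀ W) :
    ‖covDerivL2K ℂ c₀ c (adTransportW φ (fun _ : Bond d P' => (1 : 𝔸ˣ))) (siteL2Cast ℂ h l)‖ =
      ‖covDerivL2K ℂ c₀ c (adTransportW φ (fun _ : Bond d P => (1 : 𝔸ˣ))) l‖ := by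
  subst h; rfl

end Cast

/-! ## §1 The `k`-level third operator bounded below in the window: closed form -/

section Window

variable {d : ℕ} (L : ℕ) [NeZero L] (m : Fin d → ℕ) [∀ i, NeZero (m i)] (n : ℕ)
  {𝔸 : Type*} [NormedRing 𝔸] [NormedAlgebra ℂ 𝔸] [CompleteSpace 𝔸] [NormOneClass 𝔸]
  {W : Type*} [NormedAddCommGroup W] [InnerProductSpace ℂ W] [FiniteDimensional ℂ W] (φ : W ≃ₗ[ℂ] 𝔸)
  (c₀ : ℝ) [Fact (0 < c₀)] (η : ℝ) (c₁ : ℝ) [Fact (0 < c₁)]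

omit [NeZero L] in
/-- `(a + b)² ≤ 2a² + 2b²` (private arithmetic helper). [folklore] -/
private theorem add_sq_le_two_sq (a b : ℝ) : (a + b) ^ 2 ≤ 2 * a ^ 2 + 2 * b ^ 2 := by nlinarith [sq_nonneg (a - b)]

-- heartbeat headroom as in the one-shot file (`B9Eq365QGGQLowerVariationalWindow`, ops precedent p333837): the theorem head is large.
set_option maxHeartbeats 400000 in
/-- **THE `k`-LEVEL THIRD OPERATOR `Q̃′_kG′_k(U)²Q̃′_k(U)†` BOUNDED BELOW IN THE WINDOW, CLOSED FORM** (print's GENUINE composite averaging (3.19) on the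
tower, `N = L^{n+1}`): for `3 ≤ N`, `0 < a′`, a background `U` on `T_{L^{n+1}m}` with `U(b) ∈ U1`, `‖U(b) − 1‖ ≤ ε`, level averages `‖Ū^j(b) − 1‖ ≤ ε_j`
in `U1`, mutually adjoint transporters (`hRS`), the displayed positivity `hpos′` of `Δ′_{a′,k}(U)` and the WINDOW `ρ_k·(N²∕4)^d ≤ β∕2`,
`ρ_k := Π_{j≤n}(1 + 2M_φM_φ′ε_j)^{d(L−1)} − 1`, `β := ((N−1)(N−2)∕6)^d`: every coarse `ψ` has `κ_{U,k}·‖ψ‖² ≤ re⟪ψ, Q̃′_k(U)G′_k(U)²Q̃′_k(U)†ψ⟫` with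
`κ_{U,k} = ((β∕2)²∕M)²·(c₀N^d∕c₁)∕(1 + ρ_k)²`, `M = 2E + 2|η⁻¹|²(2M_φM_φ′ε)²·d·((N²∕4)^d)²(c₀N^d∕c₁) + a′(β + ρ_k(N²∕4)^d)²`,
`E = |η⁻¹|²(N(N²∕4)^{d−1})²·d·(c₀N^d∕c₁)` — the one-shot `qggq_coercive_window` VERBATIM one storey up: the tent test vector at block size `L^{n+1}`
transported by the site isometry, the flat composite average of it `= β·ψ` ([B5′] (1.18)), the transporter letter entering only through `|η⁻¹|·2M_φM_φ′ε`
and the tower averaging letter `ρ_k`; NO operator norm, NO volume.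
[cite: Balaban1985BackgroundPropagators, Thm 3.11 p.416, (3.19) p.393, (3.24)–(3.25) p.394; Balaban1984PropagatorsI, (1.18) p.20; Balaban1984PropagatorsII, (2.74)–(2.77) p.236] -/
theorem qggq_coercive_window_tower (hL3 : 3 ≤ L ^ (n + 1)) {a' : ℝ} (ha' : 0 < a') {Mφ Mφ' : ℝ} (hMφ : 0 ≤ Mφ) (hMφ' : 0 ≤ Mφ')
    (hφ : ∀ w, ‖φ w‖ ≤ Mφ * ‖w‖) (hφ' : ∀ X, ‖φ.symm X‖ ≤ Mφ' * ‖X‖)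
    (U : Bond d (towerP L m (n + 1)) → 𝔸ˣ) (hU : ∀ b, U b ∈ U1 𝔸) {ε : ℝ} (hε : 0 ≤ ε) (hUε : ∀ b, ‖(U b : 𝔸) - 1‖ ≤ ε)
    (εU : ℕ → ℝ) (hεU : ∀ j, 0 ≤ εU j)
    (hLε : ∀ (j : ℕ) (b : Bond d (towerP L m (j + 1))), ‖(UlevOf L m (n + 1) U j b : 𝔸) - 1‖ ≤ εU j)
    (hLb : ∀ (j : ℕ) (b : Bond d (towerP L m (j + 1))), UlevOf L m (n + 1) U j b ∈ U1 𝔸)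
    (hRS : ∀ (b : Bond d (towerP L m (n + 1))) (v u : W), ⟪adTransportW φ U b v, u⟫_ℂ = ⟪v, adTransportW φ (fun b => (U b)⁻¹) b u⟫_ℂ)
    (hpos' : ∀ x : SiteL2K ℂ d (towerP L m (n + 1)) c₀ W, x ≠ 0 → 0 < RCLike.re ⟪x, laplacePrimeAk L m n φ η U a' (c₁ := c₁) x⟫_ℂ)
    (hwin : ((∏ j ∈ Finset.range (n + 1), (1 + 2 * Mφ * Mφ' * εU j) ^ (d * (L - 1))) - 1) * (((L : ℝ) ^ (n + 1)) ^ 2 / 4) ^ d ≤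
      (((L : ℝ) ^ (n + 1) - 1) * ((L : ℝ) ^ (n + 1) - 2) / 6) ^ d / 2)
    (ψ : SiteL2K ℂ d m c₁ W) :
    ((((((L : ℝ) ^ (n + 1) - 1) * ((L : ℝ) ^ (n + 1) - 2) / 6) ^ d / 2) ^ 2 /
          (2 * (‖((η : ℂ))⁻¹‖ ^ 2 * ((L : ℝ) ^ (n + 1) * (((L : ℝ) ^ (n + 1)) ^ 2 / 4) ^ (d - 1)) ^ 2 * (d : ℝ) *
              (c₀ * ((L : ℝ) ^ (n + 1)) ^ d / c₁)) +
            2 * (‖((η : ℂ))⁻¹‖ ^ 2 * (2 * Mφ * Mφ' * ε) ^ 2 * (d : ℝ) * ((((L : ℝ) ^ (n + 1)) ^ 2 / 4) ^ d) ^ 2 *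
              (c₀ * ((L : ℝ) ^ (n + 1)) ^ d / c₁)) +
            a' * ((((L : ℝ) ^ (n + 1) - 1) * ((L : ℝ) ^ (n + 1) - 2) / 6) ^ d +
              ((∏ j ∈ Finset.range (n + 1), (1 + 2 * Mφ * Mφ' * εU j) ^ (d * (L - 1))) - 1) *
                (((L : ℝ) ^ (n + 1)) ^ 2 / 4) ^ d) ^ 2)) ^ 2 *
        (c₀ * ((L : ℝ) ^ (n + 1)) ^ d / c₁) /
        (1 + ((∏ j ∈ Finset.range (n + 1), (1 + 2 * Mφ * Mφ' * εU j) ^ (d * (L - 1))) - 1)) ^ 2) * ‖ψ‖ ^ 2 ≤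
      RCLike.re ⟪ψ, (((WL2.linearEquiv ℂ ℂ (fun _ : TSite d m => c₁)).symm.toLinearMap ∘ₗ QprimeTowerW L m n φ U (c₀ := c₀)) ∘ₗ
        GpOfUk L m n φ η U a' (c₁ := c₁) hpos' ∘ₗ GpOfUk L m n φ η U a' (c₁ := c₁) hpos' ∘ₗ
        LinearMap.adjoint ((WL2.linearEquiv ℂ ℂ (fun _ : TSite d m => c₁)).symm.toLinearMap ∘ₗ QprimeTowerW L m n φ U (c₀ := c₀))) ψ⟫_ℂ := by
  have hc₀ : 0 < c₀ := Fact.out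
  have hc₁ : 0 < c₁ := Fact.out
  have h : towerP L m (n + 1) = fineP (L ^ (n + 1)) m := towerP_eq_fineP_pow L m (n + 1)
  have hNr : ((L ^ (n + 1) : ℕ) : ℝ) = (L : ℝ) ^ (n + 1) := Nat.cast_pow L (n + 1)
  have hN0 : (0 : ℝ) < (L : ℝ) ^ (n + 1) := by rw [← hNr]; exact_mod_cast lt_of_lt_of_le (by norm_num) hL3
  have hN0' : (L : ℝ) ^ (n + 1) ≠ 0 := hN0.ne'
  have hN3 : (3 : ℝ) ≤ (L : ℝ) ^ (n + 1) := by rw [← hNr]; exact_mod_cast hL3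
  -- letters
  set Q : SiteL2K ℂ d (towerP L m (n + 1)) c₀ W →ₗ[ℂ] SiteL2K ℂ d m c₁ W :=
    (WL2.linearEquiv ℂ ℂ (fun _ : TSite d m => c₁)).symm.toLinearMap ∘ₗ QprimeTowerW L m n φ U (c₀ := c₀) with hQ
  set Q₁ : SiteL2K ℂ d (towerP L m (n + 1)) c₀ W →ₗ[ℂ] SiteL2K ℂ d m c₁ W :=
    (WL2.linearEquiv ℂ ℂ (fun _ : TSite d m => c₁)).symm.toLinearMap ∘ₗ
      QprimeTowerW L m n φ (fun _ : Bond d (towerP L m (n + 1)) => (1 : 𝔸ˣ)) (c₀ := c₀) with hQ₁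
  set T := laplacePrimeAk L m n φ η U a' (c₀ := c₀) (c₁ := c₁) with hT
  have hTs : T.IsSymmetric := laplacePrimeAk_isSymmetric L m n φ η U a' hRS
  set S : ℝ := ∑ k ∈ Finset.range (L ^ (n + 1)), (k : ℝ) * (((L ^ (n + 1) : ℕ) : ℝ) - 1 - k) with hS
  set β : ℝ := (((L : ℝ) ^ (n + 1) - 1) * ((L : ℝ) ^ (n + 1) - 2) / 6) ^ d with hβ
  set Bs : ℝ := (((L : ℝ) ^ (n + 1)) ^ 2 / 4) ^ d with hBs
  set D : ℝ := (L : ℝ) ^ (n + 1) * (((L : ℝ) ^ (n + 1)) ^ 2 / 4) ^ (d - 1) with hD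
  set ρw : ℝ := c₀ * ((L : ℝ) ^ (n + 1)) ^ d / c₁ with hρw
  set E : ℝ := ‖((η : ℂ))⁻¹‖ ^ 2 * D ^ 2 * (d : ℝ) * ρw with hE
  set εR : ℝ := 2 * Mφ * Mφ' * ε with hεR
  set ρ' : ℝ := (∏ j ∈ Finset.range (n + 1), (1 + 2 * Mφ * Mφ' * εU j) ^ (d * (L - 1))) - 1 with hρ'
  set E' : ℝ := ‖((η : ℂ))⁻¹‖ ^ 2 * εR ^ 2 * (d : ℝ) * Bs ^ 2 * ρw with hE'
  set M : ℝ := 2 * E + 2 * E' + a' * (β + ρ' * Bs) ^ 2 with hM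
  set sN : ℝ := Real.sqrt (c₁ / (c₀ * ((L : ℝ) ^ (n + 1)) ^ d)) with hsN
  have hβS : ((((L ^ (n + 1) : ℕ) : ℝ)) ^ d)⁻¹ * S ^ d = β := by
    rw [hS, sum_profile_eq, hNr, hβ, ← inv_pow, ← mul_pow]
    congr 1
    field_simp
  have hβ0 : 0 < β := by rw [hβ]; exact pow_pos (by nlinarith) d
  have hBs0 : 0 ≤ Bs := by rw [hBs]; positivity
  have hD0 : 0 ≤ D := by rw [hD]; positivity
  have hρw0 : 0 < ρw := by rw [hρw]; positivity
  have hεR0 : 0 ≤ εR := by rw [hεR]; positivity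
  have hK0 : 0 ≤ 2 * Mφ * Mφ' := by positivity
  have hρ'0 : 0 ≤ ρ' := by rw [hρ']; exact rhoTower_nonneg n hK0 εU hεU (d * (L - 1))
  have hE0 : 0 ≤ E := by rw [hE]; positivity
  have hE'0 : 0 ≤ E' := by rw [hE']; positivity
  have hM0 : 0 < M := by rw [hM]; positivity
  have hsN0 : 0 < sN := by rw [hsN]; positivity
  have hwin' : ρ' * Bs ≤ β / 2 := hwin
  have hsq1 : sN * Real.sqrt ρw = 1 := by
    rw [hsN, hρw, ← Real.sqrt_mul (by positivity),
      show c₁ / (c₀ * ((L : ℝ) ^ (n + 1)) ^ d) * (c₀ * ((L : ℝ) ^ (n + 1)) ^ d / c₁) = 1 by field_simp, Real.sqrt_one]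
  -- the test vector: the tent lift at block size `L^{n+1}`, carried to the tower typing by the site isometry
  set ψt := WL2.equiv ℂ (fun _ : TSite d m => c₁) W ψ with hψt
  set uN : SiteL2K ℂ d (fineP (L ^ (n + 1)) m) c₀ W := (WL2.equiv ℂ (fun _ : TSite d (fineP (L ^ (n + 1)) m) => c₀) W).symm
    (fun x => (((∏ ν, ((offset (L ^ (n + 1)) m x ν : ℕ) : ℝ) * (((L ^ (n + 1) : ℕ) : ℝ) - 1 - (offset (L ^ (n + 1)) m x ν : ℕ))) : ℝ) : ℂ) •
      ψt (blockCoord (L ^ (n + 1)) m x)) with huN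
  set u : SiteL2K ℂ d (towerP L m (n + 1)) c₀ W := (siteL2Cast ℂ h).symm uN with hu
  have hcast : siteL2Cast ℂ h u = uN := LinearEquiv.apply_symm_apply _ _
  have hQ₁u : Q₁ u = ((β : ℝ) : ℂ) • ψ := by
    have e1 : Q₁ u = ((WL2.linearEquiv ℂ ℂ (fun _ : TSite d m => c₁)).symm.toLinearMap ∘ₗ
        QprimeW (L ^ (n + 1)) m φ (fun _ : Bond d (fineP (L ^ (n + 1)) m) => (1 : 𝔸ˣ)) (c₀ := c₀)) uN := by
      rw [hQ₁, Qtildek_one_eq_oneStep L m n φ h, LinearMap.comp_apply, LinearEquiv.coe_toLinearMap, hcast]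
    rw [e1, ← hβS, huN]
    exact QprimeWL2_one_lift (L ^ (n + 1)) m φ c₀ c₁ _ (fun y => sum_blockOf_tent (L ^ (n + 1)) m y) ψ
  have hnu : ‖u‖ = ‖uN‖ := by rw [← norm_siteL2Cast ℂ h u, hcast]
  have hun : ‖u‖ ^ 2 ≤ Bs ^ 2 * ρw * ‖ψ‖ ^ 2 := by
    have h1 := norm_sq_lift_le (L ^ (n + 1)) m c₀ c₁
      (fun x => ∏ ν, ((offset (L ^ (n + 1)) m x ν : ℕ) : ℝ) * (((L ^ (n + 1) : ℕ) : ℝ) - 1 - (offset (L ^ (n + 1)) m x ν : ℕ)))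
      (abs_tent_le (L ^ (n + 1)) m) ψ
    rw [hnu, hBs, hρw, ← hNr]
    exact h1
  have hun' : ‖u‖ ≤ Bs * Real.sqrt ρw * ‖ψ‖ := by
    have h2 : (Bs * Real.sqrt ρw * ‖ψ‖) ^ 2 = Bs ^ 2 * ρw * ‖ψ‖ ^ 2 := by rw [mul_pow, mul_pow, Real.sq_sqrt hρw0.le]
    exact (pow_le_pow_iff_left₀ (norm_nonneg _) (by positivity) two_ne_zero).1 (h2 ▸ hun)
  -- the transporter letter (finest level) and the tower averaging letters
  have hR : ∀ (b : Bond d (towerP L m (n + 1))) (w : W), ‖adTransportW φ U b w - w‖ ≤ εR * ‖w‖ := fun b w => by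
    rw [hεR]; exact norm_adTransportW_sub_le φ hφ hφ' hMφ' U b (hU b) (hUε b) w
  have hR₁ : ∀ (b : Bond d (towerP L m (n + 1))) (w : W), adTransportW φ (fun _ : Bond d (towerP L m (n + 1)) => (1 : 𝔸ˣ)) b w = w :=
    fun b w => by rw [adTransportW_one]; rfl
  have hQl : ∀ v, ‖Q v - Q₁ v‖ ≤ ρ' * sN * ‖v‖ := fun v =>
    norm_QtildeTower_sub_flat_le L m n φ hMφ hMφ' hφ hφ' (c₀ := c₀) c₁ U εU hεU hLε hLb v
  have hQ1l : ∀ v, ‖Q₁ v‖ ≤ sN * ‖v‖ := fun v => norm_QtildeTower_one_le L m n φ (c₀ := c₀) c₁ (𝔸 := 𝔸) v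
  have hδ : ‖Q u - Q₁ u‖ ≤ ρ' * Bs * ‖ψ‖ :=
    calc ‖Q u - Q₁ u‖ ≤ ρ' * sN * ‖u‖ := hQl u
      _ ≤ ρ' * sN * (Bs * Real.sqrt ρw * ‖ψ‖) := mul_le_mul_of_nonneg_left hun' (by positivity)
      _ = ρ' * Bs * (sN * Real.sqrt ρw) * ‖ψ‖ := by ring
      _ = ρ' * Bs * ‖ψ‖ := by rw [hsq1, mul_one]
  have hQu : Q u = ((β : ℝ) : ℂ) • ψ + (Q u - Q₁ u) := by rw [hQ₁u]; abel
  -- (1) `(β∕2)‖ψ‖² ≤ re⟪u, Q†ψ⟫`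
  have hux : β / 2 * ‖ψ‖ ^ 2 ≤ RCLike.re ⟪u, LinearMap.adjoint Q ψ⟫_ℂ := by
    rw [LinearMap.adjoint_inner_right, hQu, inner_add_left, map_add, inner_smul_left, Complex.conj_ofReal]
    have e1 : RCLike.re ((β : ℂ) * ⟪ψ, ψ⟫_ℂ) = β * ‖ψ‖ ^ 2 := by
      rw [← inner_self_eq_norm_sq (𝕜 := ℂ) ψ]; simp only [RCLike.re_to_complex, Complex.re_ofReal_mul]
    rw [e1]
    have e2 : |RCLike.re ⟪Q u - Q₁ u, ψ⟫_ℂ| ≤ ρ' * Bs * ‖ψ‖ * ‖ψ‖ :=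
      (RCLike.abs_re_le_norm _).trans ((norm_inner_le_norm _ _).trans (mul_le_mul_of_nonneg_right hδ (norm_nonneg _)))
    have e3 := neg_le_of_abs_le e2
    have h5 : ρ' * Bs * ‖ψ‖ * ‖ψ‖ ≤ β / 2 * ‖ψ‖ ^ 2 := by
      rw [mul_assoc (ρ' * Bs), ← pow_two]; exact mul_le_mul_of_nonneg_right hwin' (sq_nonneg _)
    linarith [e3, h5]
  -- (2) `re⟪u, Tu⟫ ≤ M‖ψ‖²`
  have huu : RCLike.re ⟪u, T u⟫_ℂ ≤ M * ‖ψ‖ ^ 2 := by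
    rw [hT, re_inner_laplacePrimeAk L m n φ η U a' hRS u]
    -- Dirichlet part at the flat background: the one-shot tent energy at block size `L^{n+1}`, read through the site isometry
    have hD1 := norm_sq_covDerivL2K_lift_le (L ^ (n + 1)) m φ c₀ η c₁
      (fun x => ∏ ν, ((offset (L ^ (n + 1)) m x ν : ℕ) : ℝ) * (((L ^ (n + 1) : ℕ) : ℝ) - 1 - (offset (L ^ (n + 1)) m x ν : ℕ)))
      (D := ((L ^ (n + 1) : ℕ) : ℝ) * ((((L ^ (n + 1) : ℕ) : ℝ)) ^ 2 / 4) ^ (d - 1)) ψ (norm_tent_step_le (L ^ (n + 1)) m ψt)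
    have hD1' : ‖covDerivL2K ℂ c₀ ((η : ℂ))⁻¹ (adTransportW φ (fun _ : Bond d (towerP L m (n + 1)) => (1 : 𝔸ˣ))) u‖ ^ 2 ≤ E * ‖ψ‖ ^ 2 := by
      have e1 : ‖covDerivL2K ℂ c₀ ((η : ℂ))⁻¹ (adTransportW φ (fun _ : Bond d (towerP L m (n + 1)) => (1 : 𝔸ˣ))) u‖ =
          ‖covDerivL2K ℂ c₀ ((η : ℂ))⁻¹ (adTransportW φ (fun _ : Bond d (fineP (L ^ (n + 1)) m) => (1 : 𝔸ˣ))) uN‖ := by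
        rw [hu, siteL2Cast_symm_apply, norm_covDerivL2K_one_siteL2Cast]
      rw [e1, hE, hD, hρw, ← hNr]
      exact hD1
    -- `‖D_U u‖ ≤ ‖D_1 u‖ + |η⁻¹|εR√d‖u‖`
    have hdiff := norm_covDerivL2K_sub_le (𝕜 := ℂ) (c₀ := c₀) (c := ((η : ℂ))⁻¹) (R := adTransportW φ U)
      (R₁ := adTransportW φ (fun _ : Bond d (towerP L m (n + 1)) => (1 : 𝔸ˣ))) hεR0 hR hR₁ u
    have hDU : ‖covDerivL2K ℂ c₀ ((η : ℂ))⁻¹ (adTransportW φ U) u‖ ≤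
        ‖covDerivL2K ℂ c₀ ((η : ℂ))⁻¹ (adTransportW φ (fun _ : Bond d (towerP L m (n + 1)) => (1 : 𝔸ˣ))) u‖ +
          ‖((η : ℂ))⁻¹‖ * εR * Real.sqrt d * ‖u‖ :=
      (norm_le_insert' _ _).trans (add_le_add le_rfl hdiff)
    have ha₁ : ‖covDerivL2K ℂ c₀ ((η : ℂ))⁻¹ (adTransportW φ (fun _ : Bond d (towerP L m (n + 1)) => (1 : 𝔸ˣ))) u‖ ≤ Real.sqrt E * ‖ψ‖ := by
      have h2 : (Real.sqrt E * ‖ψ‖) ^ 2 = E * ‖ψ‖ ^ 2 := by rw [mul_pow, Real.sq_sqrt hE0]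
      exact (pow_le_pow_iff_left₀ (norm_nonneg _) (by positivity) two_ne_zero).1 (h2 ▸ hD1')
    have ha₂ : ‖((η : ℂ))⁻¹‖ * εR * Real.sqrt d * ‖u‖ ≤ ‖((η : ℂ))⁻¹‖ * εR * Real.sqrt d * (Bs * Real.sqrt ρw * ‖ψ‖) :=
      mul_le_mul_of_nonneg_left hun' (by positivity)
    have hDU' : ‖covDerivL2K ℂ c₀ ((η : ℂ))⁻¹ (adTransportW φ U) u‖ ≤
        (Real.sqrt E + ‖((η : ℂ))⁻¹‖ * εR * Real.sqrt d * Bs * Real.sqrt ρw) * ‖ψ‖ := by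
      refine hDU.trans ?_
      refine (add_le_add ha₁ ha₂).trans (le_of_eq ?_)
      ring
    have hsq : ‖covDerivL2K ℂ c₀ ((η : ℂ))⁻¹ (adTransportW φ U) u‖ ^ 2 ≤ (2 * E + 2 * E') * ‖ψ‖ ^ 2 := by
      have h1 : ‖covDerivL2K ℂ c₀ ((η : ℂ))⁻¹ (adTransportW φ U) u‖ ^ 2 ≤
          ((Real.sqrt E + ‖((η : ℂ))⁻¹‖ * εR * Real.sqrt d * Bs * Real.sqrt ρw) * ‖ψ‖) ^ 2 :=
        pow_le_pow_left₀ (norm_nonneg _) hDU' 2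
      refine h1.trans ?_
      have hd0 : (0 : ℝ) ≤ d := Nat.cast_nonneg d
      have e1 : ((Real.sqrt E + ‖((η : ℂ))⁻¹‖ * εR * Real.sqrt d * Bs * Real.sqrt ρw) * ‖ψ‖) ^ 2 ≤
          (2 * (Real.sqrt E) ^ 2 + 2 * (‖((η : ℂ))⁻¹‖ * εR * Real.sqrt d * Bs * Real.sqrt ρw) ^ 2) * ‖ψ‖ ^ 2 := by
        rw [mul_pow]
        exact mul_le_mul_of_nonneg_right (add_sq_le_two_sq _ _) (sq_nonneg _)
      refine e1.trans (le_of_eq ?_)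
      rw [Real.sq_sqrt hE0, mul_pow, mul_pow, mul_pow, mul_pow, Real.sq_sqrt hd0, Real.sq_sqrt hρw0.le, hE']
    -- averaging part: `‖Q u‖ ≤ (β + ρ_k B_s)‖ψ‖`
    have hQn : ‖Q u‖ ≤ (β + ρ' * Bs) * ‖ψ‖ := by
      rw [hQu]
      refine (norm_add_le _ _).trans ?_
      rw [norm_smul, Complex.norm_real, Real.norm_eq_abs, abs_of_pos hβ0, add_mul]
      exact add_le_add le_rfl hδ
    have hQsq : a' * ‖Q u‖ ^ 2 ≤ a' * ((β + ρ' * Bs) ^ 2 * ‖ψ‖ ^ 2) := by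
      refine mul_le_mul_of_nonneg_left ?_ ha'.le
      rw [← mul_pow]; exact pow_le_pow_left₀ (norm_nonneg _) hQn 2
    rw [← hQ]
    calc _ ≤ (2 * E + 2 * E') * ‖ψ‖ ^ 2 + a' * ((β + ρ' * Bs) ^ 2 * ‖ψ‖ ^ 2) := add_le_add hsq hQsq
      _ = M * ‖ψ‖ ^ 2 := by rw [hM]; ring
  -- (3) the first-order variational principle: `κ₁‖ψ‖² ≤ re⟪Q†ψ, G′_k(U)Q†ψ⟫`, `κ₁ = (β∕2)²∕M`
  have hG : ∀ z, GpOfUk L m n φ η U a' (c₁ := c₁) hpos' z = greenK T hpos' z := fun z => rfl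
  have hκ₁ := sq_div_mul_le_re_inner_green hTs hpos' hM0 (by positivity : (0 : ℝ) ≤ β / 2) hux huu
  -- (4) Cauchy–Schwarz with `‖Q̃′_k(U)‖ ≤ (1 + ρ_k)·√(c₁∕(c₀N^d))`
  have hN1 : 0 < (1 + ρ') * sN := by positivity
  have hQv : ∀ v, ‖Q v‖ ≤ (1 + ρ') * sN * ‖v‖ := fun v =>
    calc ‖Q v‖ ≤ ‖Q₁ v‖ + ‖Q v - Q₁ v‖ := norm_le_insert' _ _
      _ ≤ sN * ‖v‖ + ρ' * sN * ‖v‖ := add_le_add (hQ1l v) (hQl v)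
      _ = (1 + ρ') * sN * ‖v‖ := by ring
  have hfin := sq_mul_norm_sq_le_re_inner_qggq hTs hpos' Q hN1 (div_nonneg (sq_nonneg _) hM0.le) hQv ψ hκ₁
  -- (5) the constant
  have hconst : ((β / 2) ^ 2 / M / ((1 + ρ') * sN)) ^ 2 = ((β / 2) ^ 2 / M) ^ 2 * (c₀ * ((L : ℝ) ^ (n + 1)) ^ d / c₁) / (1 + ρ') ^ 2 := by
    rw [hsN, div_pow, mul_pow, Real.sq_sqrt (by positivity)]
    field_simp
  rw [hconst, hM, hE, hE', hD, hBs, hρw, hρ', hεR] at hfin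
  simpa only [LinearMap.comp_apply, hG] using hfin

end Window

end Literature.MathematicalPhysics.QuantumFieldTheory.Balaban1983to89.B9Eq365QGGQLowerVariationalWindowTower

end
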